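import Mathlib.RingTheory.Ideal.Lattice
import Mathlib.RingTheory.Ideal.Quotient.Defs
import Literature.Computability.AlgebraicComplexity.ArithCircuit
import HarnessLib

/-!
# Complexity of cosets of ideals (representative complexity)

Topic `Literature/Computability/AlgebraicComplexity`; definition item `defn-cosetComplexity`
(requested by route `ValiantsHypothesis/HartogsRankTwo`, card *hartogs-on-rank-two*).

For an ideal `I ≤ k[σ]` (`MvPolynomial σ k`) and a polynomial `f`, the **coset complexity**
(representative complexity) of `f` modulo `I` is the least circuit complexity of an element of the
coset `f + I`:

  `cosetComplexity I f = min { complexity P : P ∈ f + I } = min { complexity (f + g) : g ∈ I }`,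

`complexity` being the tree's fan-in-two circuit complexity (`ArithCircuit.lean`, Bürgisser 2000,
Def. 2.1). The minimum is attained and the defining set is never empty (`g = 0`), so no junk value
enters `cosetComplexity`. It is defined through the auxiliary

  `infComplexity S = min { complexity P : P ∈ S }` (`sInf`, junk value `0` for `S = ∅`),

the least complexity of a member of a set of polynomials — the quantity bounded from below by
"lower bounds for (nonzero) cosets of ideals" (Andrews–Forbes 2022, §1.3; Grochow–Pitassi 2018, §6:
the IPS certificates of a fixed unsatisfiable system form a coset of the ideal of zero-certificates,
and General Question 1.16 of the arXiv version asks for the complexity structure of the families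
`(f_n) ∈ (f⁽⁰⁾_n + I_n)`), and, with `S = I \ {0}`, by "the minimum possible complexity of a nonzero
polynomial in an ideal" (Andrews–Forbes 2022, §1.1).

Motivating instance (route HartogsRankTwo): `c_r(n) := cosetComplexity (I_{r+1}) per_n` with
`I_{r+1}` the ideal of `(r+1) × (r+1)` minors of the generic `n × n` matrix (the tree's `detIdeal`);
the route's target `HartogsTwo` says that `c_2` is not p-bounded. With `cosetComplexity_le_iff_sub_mem`
such statements read `¬ ∃ c, ∀ n, cosetComplexity (I n) (f n) ≤ n ^ c + c`.

## Sources

* [GrochowPitassi2018] J. A. Grochow, T. Pitassi, *Circuit complexity, proof complexity, and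
  polynomial identity testing: the Ideal Proof System*, J. ACM 65 (2018), §6 (= arXiv:1404.3820
  §1.6 "Towards lower bounds", Lemma 1.12, and §1.7 General Question 1.16).
* [AndrewsForbes2022] R. Andrews, M. A. Forbes, *Ideals, determinants, and straightening*,
  STOC 2022, arXiv:2112.00792, §1.1 (complexity of ideals) and §1.3 (cosets of ideals and IPS).
* [Burgisser2000] P. Bürgisser, *Completeness and Reduction in Algebraic Complexity Theory*,
  Def. 2.1 (the measure `complexity`).

## Design choices

* Stated for a commutative **semiring** `k` of coefficients, with the coset written additively as
  the image `(f + ·) '' I = {f + g | g ∈ I}` (no subtraction needed); over a commutative **ring**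
  this is the set `{P | P - f ∈ I}` of the request (`cosetComplexity_eq_sInf_sub_mem`), the value
  only depends on the class of `f` in `k[σ] ⧸ I` (`cosetComplexity_eq_of_mk_eq`), and it vanishes on
  `I` itself (`cosetComplexity_of_mem`: the coset of `f ∈ I` contains `0`).
* Over a semiring only the inequality `cosetComplexity I f ≤ cosetComplexity I (f + g)` (`g ∈ I`)
  holds in general; equality (`cosetComplexity_add_of_mem`) needs additive inverses.
* API: unfolding lemmas, `cosetComplexity I f ≤ complexity f`, attainment, `≤`/`≥` characterisations,
  antitonicity in `I`, `cosetComplexity ⊥ f = complexity f`, `cosetComplexity ⊤ f = 0` (ring),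
  translation invariance along `I`.
* Mathlib has no circuit-complexity notion, hence nothing of this kind (searched `cosetComplexity`,
  `infComplexity`, `minComplexity`); the tree's `complexity`, Mathlib's `Ideal`,
  `Ideal.Quotient.mk` are reused. Nothing here is specific to determinantal ideals: `detIdeal`
  (`BideterminantReduction.lean`) is deliberately not imported.

## What is not here

No lower or upper bounds for specific cosets (those are route items), no border/approximative
version, no constant-free variant (replace `complexity` by `constantFreeComplexity` verbatim if
needed), and no quotient-level bundling `k[σ] ⧸ I → ℕ` (immediate from `cosetComplexity_eq_of_mk_eq`).
-/

noncomputable section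

open MvPolynomial

open scoped Pointwise

namespace Literature.Computability.AlgebraicComplexity

universe u v

/-! ### Least complexity of a member of a set of polynomials -/

section InfComplexity

variable {k : Type u} {σ : Type v} [CommSemiring k]

/-- The least circuit complexity of a member of a set `S` of polynomials,
`infComplexity S = min {complexity P | P ∈ S}` (as an `sInf` over `ℕ`; the minimum is attained when
`S` is nonempty, `exists_complexity_eq_infComplexity`, and the junk value `sInf ∅ = 0` applies for
`S = ∅`, `infComplexity_empty`). A "circuit lower bound for the set `S`" (for all of its members) is
exactly a lower bound for this number; with `S = I \ {0}` it is the minimum complexity of a nonzero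
polynomial in the ideal `I` (Andrews–Forbes 2022, §1.1), with `S = f + I` the coset complexity
below (ibid. §1.3). [cite: AndrewsForbes2022, §1.1 and §1.3] -/
def infComplexity (S : Set (MvPolynomial σ k)) : ℕ :=
  sInf (complexity '' S)

/-- Unfolding lemma for `infComplexity`. [folklore] -/
theorem infComplexity_def (S : Set (MvPolynomial σ k)) :
    infComplexity S = sInf (complexity '' S) := rfl

/-- The junk case: `infComplexity ∅ = sInf ∅ = 0`. [folklore] -/
@[simp]
theorem infComplexity_empty : infComplexity (∅ : Set (MvPolynomial σ k)) = 0 := by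
  simp [infComplexity]

/-- `infComplexity S` is a lower bound for the complexity of every member of `S`. [folklore] -/
theorem infComplexity_le_complexity {S : Set (MvPolynomial σ k)} {P : MvPolynomial σ k}
    (hP : P ∈ S) : infComplexity S ≤ complexity P :=
  Nat.sInf_le ⟨P, hP, rfl⟩

/-- For a nonempty set the least complexity is attained by some member. [folklore] -/
theorem exists_complexity_eq_infComplexity {S : Set (MvPolynomial σ k)} (hS : S.Nonempty) :
    ∃ P ∈ S, complexity P = infComplexity S := by
  obtain ⟨P, hP, hPe⟩ := Nat.sInf_mem (hS.image complexity)
  exact ⟨P, hP, hPe⟩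

/-- A single polynomial: `infComplexity {f} = complexity f`. [folklore] -/
@[simp]
theorem infComplexity_singleton (f : MvPolynomial σ k) : infComplexity {f} = complexity f := by
  simp [infComplexity]

/-- Upper bounds: `infComplexity S ≤ B` iff some member of `S` has complexity `≤ B`
(`S` nonempty). [folklore] -/
theorem infComplexity_le_iff {S : Set (MvPolynomial σ k)} (hS : S.Nonempty) {B : ℕ} :
    infComplexity S ≤ B ↔ ∃ P ∈ S, complexity P ≤ B := by
  refine ⟨fun h => ?_, fun ⟨P, hP, hPB⟩ => (infComplexity_le_complexity hP).trans hPB⟩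
  obtain ⟨P, hP, hPe⟩ := exists_complexity_eq_infComplexity hS
  exact ⟨P, hP, hPe.trans_le h⟩

/-- Lower bounds: `B ≤ infComplexity S` iff every member of `S` has complexity `≥ B`
(`S` nonempty) — a "lower bound for the set `S`". [folklore] -/
theorem le_infComplexity_iff {S : Set (MvPolynomial σ k)} (hS : S.Nonempty) {B : ℕ} :
    B ≤ infComplexity S ↔ ∀ P ∈ S, B ≤ complexity P := by
  refine ⟨fun h P hP => h.trans (infComplexity_le_complexity hP), fun h => ?_⟩
  obtain ⟨P, hP, hPe⟩ := exists_complexity_eq_infComplexity hS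
  exact (h P hP).trans_eq hPe

/-- `infComplexity` is antitone on nonempty sets: enlarging the set can only lower the least
complexity. (Nonemptiness of the smaller set is needed because of the junk value at `∅`.) [folklore] -/
theorem infComplexity_anti {S T : Set (MvPolynomial σ k)} (hST : S ⊆ T) (hS : S.Nonempty) :
    infComplexity T ≤ infComplexity S := by
  obtain ⟨P, hP, hPe⟩ := exists_complexity_eq_infComplexity hS
  rw [← hPe]
  exact infComplexity_le_complexity (hST hP)

end InfComplexity

/-! ### Coset complexity modulo an ideal -/

section Semiring

variable {k : Type u} {σ : Type v} [CommSemiring k]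

/-- The **coset complexity** (representative complexity) of `f` modulo the ideal `I ≤ k[σ]`: the
least circuit complexity `complexity P` of an element `P` of the coset `f + I = {f + g | g ∈ I}`,
i.e. `min {complexity (f + g) | g ∈ I}`; over a ring equivalently `min {complexity P | P - f ∈ I}`
(`cosetComplexity_eq_sInf_sub_mem`). The defining set is nonempty (`g = 0`) and the minimum is
attained (`exists_mem_complexity_add_eq`), so no junk value is involved. This is the quantity that
"circuit lower bounds for nonzero cosets of ideals" bound from below (Andrews–Forbes 2022, §1.3;
Grochow–Pitassi 2018, §6: all IPS certificates of a fixed system form a coset `C + I` of the ideal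
of zero-certificates, so an IPS size lower bound is a lower bound for `cosetComplexity I C`).
[cite: AndrewsForbes2022, §1.3] -/
def cosetComplexity (I : Ideal (MvPolynomial σ k)) (f : MvPolynomial σ k) : ℕ :=
  infComplexity ((f + ·) '' (I : Set (MvPolynomial σ k)))

/-- Unfolding lemma: `cosetComplexity I f` is the `infComplexity` of the coset, written as the image
`(f + ·) '' I`. [folklore] -/
theorem cosetComplexity_def (I : Ideal (MvPolynomial σ k)) (f : MvPolynomial σ k) :
    cosetComplexity I f = infComplexity ((f + ·) '' (I : Set (MvPolynomial σ k))) := rfl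

/-- The same with the coset in Mathlib's pointwise notation `f +ᵥ ↑I`. [folklore] -/
theorem cosetComplexity_eq_infComplexity_vadd (I : Ideal (MvPolynomial σ k)) (f : MvPolynomial σ k) :
    cosetComplexity I f = infComplexity (f +ᵥ (I : Set (MvPolynomial σ k))) := by
  rw [cosetComplexity, ← Set.image_vadd]
  rfl

/-- Unfolding lemma, `sInf` form: `cosetComplexity I f = sInf {s | ∃ g ∈ I, complexity (f + g) = s}`.
[folklore] -/
theorem cosetComplexity_eq_sInf (I : Ideal (MvPolynomial σ k)) (f : MvPolynomial σ k) :
    cosetComplexity I f = sInf {s | ∃ g ∈ I, complexity (f + g) = s} := by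
  rw [cosetComplexity, infComplexity, Set.image_image]
  rfl

/-- The coset `f + I` is nonempty: it contains `f = f + 0`. [folklore] -/
theorem image_add_ideal_nonempty (I : Ideal (MvPolynomial σ k)) (f : MvPolynomial σ k) :
    ((f + ·) '' (I : Set (MvPolynomial σ k))).Nonempty :=
  ⟨f + 0, 0, I.zero_mem, rfl⟩

/-- Every representative bounds the coset complexity: `cosetComplexity I f ≤ complexity (f + g)` for
`g ∈ I`. [folklore] -/
theorem cosetComplexity_le_complexity_add {I : Ideal (MvPolynomial σ k)} {f g : MvPolynomial σ k}
    (hg : g ∈ I) : cosetComplexity I f ≤ complexity (f + g) :=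
  infComplexity_le_complexity ⟨g, hg, rfl⟩

/-- In particular (`g = 0`): `cosetComplexity I f ≤ complexity f`. [folklore] -/
theorem cosetComplexity_le_complexity (I : Ideal (MvPolynomial σ k)) (f : MvPolynomial σ k) :
    cosetComplexity I f ≤ complexity f := by
  simpa only [add_zero] using cosetComplexity_le_complexity_add (f := f) I.zero_mem

/-- The minimum is attained: some representative `f + g`, `g ∈ I`, has complexity exactly
`cosetComplexity I f`. [folklore] -/
theorem exists_mem_complexity_add_eq (I : Ideal (MvPolynomial σ k)) (f : MvPolynomial σ k) :
    ∃ g ∈ I, complexity (f + g) = cosetComplexity I f := by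
  obtain ⟨_, ⟨g, hg, rfl⟩, hPe⟩ :=
    exists_complexity_eq_infComplexity (image_add_ideal_nonempty I f)
  exact ⟨g, hg, hPe⟩

/-- Upper bounds: `cosetComplexity I f ≤ B` iff some representative `f + g`, `g ∈ I`, has
complexity `≤ B`. [folklore] -/
theorem cosetComplexity_le_iff {I : Ideal (MvPolynomial σ k)} {f : MvPolynomial σ k} {B : ℕ} :
    cosetComplexity I f ≤ B ↔ ∃ g ∈ I, complexity (f + g) ≤ B := by
  rw [cosetComplexity, infComplexity_le_iff (image_add_ideal_nonempty I f)]
  constructor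
  · rintro ⟨_, ⟨g, hg, rfl⟩, hB⟩
    exact ⟨g, hg, hB⟩
  · rintro ⟨g, hg, hB⟩
    exact ⟨f + g, ⟨g, hg, rfl⟩, hB⟩

/-- Lower bounds ("the coset `f + I` is hard"): `B ≤ cosetComplexity I f` iff every representative
`f + g`, `g ∈ I`, has complexity `≥ B`. [folklore] -/
theorem le_cosetComplexity_iff {I : Ideal (MvPolynomial σ k)} {f : MvPolynomial σ k} {B : ℕ} :
    B ≤ cosetComplexity I f ↔ ∀ g ∈ I, B ≤ complexity (f + g) := by
  rw [cosetComplexity, le_infComplexity_iff (image_add_ideal_nonempty I f)]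
  constructor
  · intro h g hg
    exact h (f + g) ⟨g, hg, rfl⟩
  · rintro h _ ⟨g, hg, rfl⟩
    exact h g hg

/-- Antitonicity in the ideal: enlarging `I` enlarges the coset and can only lower the coset
complexity, `I ≤ J → cosetComplexity J f ≤ cosetComplexity I f`. [folklore] -/
theorem cosetComplexity_anti {I J : Ideal (MvPolynomial σ k)} (hIJ : I ≤ J) (f : MvPolynomial σ k) :
    cosetComplexity J f ≤ cosetComplexity I f := by
  refine infComplexity_anti ?_ (image_add_ideal_nonempty I f)
  rintro _ ⟨g, hg, rfl⟩
  exact ⟨g, hIJ hg, rfl⟩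

/-- `I ↦ cosetComplexity I f` is an antitone function on the lattice of ideals. [folklore] -/
theorem cosetComplexity_antitone (f : MvPolynomial σ k) :
    Antitone fun I : Ideal (MvPolynomial σ k) => cosetComplexity I f :=
  fun _ _ hIJ => cosetComplexity_anti hIJ f

/-- Modulo the zero ideal the coset is `{f}`: `cosetComplexity ⊥ f = complexity f`. [folklore] -/
@[simp]
theorem cosetComplexity_bot (f : MvPolynomial σ k) :
    cosetComplexity (⊥ : Ideal (MvPolynomial σ k)) f = complexity f := by
  refine le_antisymm (cosetComplexity_le_complexity ⊥ f) (le_cosetComplexity_iff.2 fun g hg => ?_)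
  rw [Ideal.mem_bot] at hg
  rw [hg, add_zero]

/-- Translating `f` by an element of `I` shrinks the coset set-theoretically
(`(f + g) + I ⊆ f + I`), hence `cosetComplexity I f ≤ cosetComplexity I (f + g)`; over a semiring
this is all one can say (over a ring: equality, `cosetComplexity_add_of_mem`). [folklore] -/
theorem cosetComplexity_le_cosetComplexity_add {I : Ideal (MvPolynomial σ k)} {f g : MvPolynomial σ k}
    (hg : g ∈ I) : cosetComplexity I f ≤ cosetComplexity I (f + g) := by
  refine le_cosetComplexity_iff.2 fun h hh => ?_
  rw [add_assoc]
  exact cosetComplexity_le_complexity_add (I.add_mem hg hh)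

end Semiring

section Ring

variable {k : Type u} {σ : Type v} [CommRing k]

/-- Over a ring, the form of the definition request: `cosetComplexity I f = sInf {s | ∃ P,
P - f ∈ I ∧ complexity P = s}` — the least complexity of a polynomial congruent to `f` modulo `I`.
[folklore] -/
theorem cosetComplexity_eq_sInf_sub_mem (I : Ideal (MvPolynomial σ k)) (f : MvPolynomial σ k) :
    cosetComplexity I f = sInf {s | ∃ P, P - f ∈ I ∧ complexity P = s} := by
  rw [cosetComplexity_eq_sInf]
  congr 1
  ext s
  constructor
  · rintro ⟨g, hg, rfl⟩
    exact ⟨f + g, by rwa [add_sub_cancel_left], rfl⟩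
  · rintro ⟨P, hP, rfl⟩
    exact ⟨P - f, hP, by rw [add_sub_cancel]⟩

/-- Over a ring: `cosetComplexity I f ≤ B` iff some `P ≡ f (mod I)` has `complexity P ≤ B` — the
shape in which "`f` has a cheap representative modulo `I`" appears in route statements. [folklore] -/
theorem cosetComplexity_le_iff_sub_mem {I : Ideal (MvPolynomial σ k)} {f : MvPolynomial σ k}
    {B : ℕ} : cosetComplexity I f ≤ B ↔ ∃ P, P - f ∈ I ∧ complexity P ≤ B := by
  rw [cosetComplexity_le_iff]
  constructor
  · rintro ⟨g, hg, hB⟩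
    exact ⟨f + g, by rwa [add_sub_cancel_left], hB⟩
  · rintro ⟨P, hP, hB⟩
    exact ⟨P - f, hP, by rwa [add_sub_cancel]⟩

/-- Over a ring, translation invariance along the ideal: `cosetComplexity I (f + g) =
cosetComplexity I f` for `g ∈ I` (the cosets coincide). [folklore] -/
theorem cosetComplexity_add_of_mem {I : Ideal (MvPolynomial σ k)} {f g : MvPolynomial σ k}
    (hg : g ∈ I) : cosetComplexity I (f + g) = cosetComplexity I f := by
  refine le_antisymm ?_ (cosetComplexity_le_cosetComplexity_add hg)
  have h := cosetComplexity_le_cosetComplexity_add (f := f + g) (I.neg_mem hg)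
  rwa [add_neg_cancel_right] at h

/-- Over a ring, `cosetComplexity I` only depends on the class modulo `I`:
`f - f' ∈ I → cosetComplexity I f = cosetComplexity I f'`. [folklore] -/
theorem cosetComplexity_eq_of_sub_mem {I : Ideal (MvPolynomial σ k)} {f f' : MvPolynomial σ k}
    (h : f - f' ∈ I) : cosetComplexity I f = cosetComplexity I f' := by
  have h' := cosetComplexity_add_of_mem (f := f') h
  rwa [add_sub_cancel] at h'

/-- Over a ring, `cosetComplexity I` factors through the quotient map `k[σ] → k[σ] ⧸ I`. [folklore] -/
theorem cosetComplexity_eq_of_mk_eq {I : Ideal (MvPolynomial σ k)} {f f' : MvPolynomial σ k}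
    (h : Ideal.Quotient.mk I f = Ideal.Quotient.mk I f') :
    cosetComplexity I f = cosetComplexity I f' :=
  cosetComplexity_eq_of_sub_mem (Ideal.Quotient.eq.1 h)

/-- Over a ring, the coset of an element of `I` is `I` itself and contains `0`, which is free:
`f ∈ I → cosetComplexity I f = 0` (so coset complexity is of interest only for `f ∉ I`, the
"nonzero cosets" of Andrews–Forbes 2022, §1.3). [cite: AndrewsForbes2022, §1.3] -/
theorem cosetComplexity_of_mem {I : Ideal (MvPolynomial σ k)} {f : MvPolynomial σ k} (hf : f ∈ I) :
    cosetComplexity I f = 0 := by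
  have h0 : complexity (0 : MvPolynomial σ k) = 0 := by
    simpa only [C_0] using complexity_C_holds (k := k) (σ := σ) 0
  have h := cosetComplexity_le_complexity_add (f := f) (I.neg_mem hf)
  rw [add_neg_cancel, h0] at h
  exact Nat.le_zero.1 h

/-- In particular modulo the unit ideal everything is free: `cosetComplexity ⊤ f = 0`. [folklore] -/
@[simp]
theorem cosetComplexity_top (f : MvPolynomial σ k) :
    cosetComplexity (⊤ : Ideal (MvPolynomial σ k)) f = 0 :=
  cosetComplexity_of_mem Submodule.mem_top

end Ring

end Literature.Computability.AlgebraicComplexity
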